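import Summits.Ventures.Crystal3D.Bulk.CapCutHalf
import Mathlib.Algebra.BigOperators.Option
import HarnessLib

/-!
# Soundness of the pole-augmented («X2») cap certificates, I: positivity and the accounting

HONEST FRAMING. Part of the venture `Summits/Ventures/Crystal3D` (cell `pub-crystal3d`, phase 2,
decision sprint; seat p1). A TRUST-BASE item, not a new number: this file and `Bulk/CapX2Cert.lean`
prove IN THE KERNEL (standard axioms) the soundness of the cell's «X2» certificates for codes in
spherical caps (theory-1 `CAP-MARGINAL.md` §8.5/§8.5′/§8.8, theory-2 `SCORE-DESIGN.md` §21.9.8,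
`capsdp/FORMAT-t2x2.md` «WHAT IS CERTIFIED») — exactly the implication the exact checkers
(`capx2cert.py`, `capcheck3.py` rev3, the ref-2 replay, idea-2 `x2cert`) take for granted when they
verify the conditions (I)(II)(III)(N) of a certificate. NO certificate and NO polynomial inequality is
asserted anywhere in these two files.

THE ARGUMENT (Bachoc–Vallentin positivity twice, then bookkeeping). Let `C ⊂ S²` be a finite `s`-code
(pairwise inner products `≤ s`) inside the cap `{x : ⟪e, x⟫ ≥ u₀}`, `p := -e`, `u_x := ⟪e, x⟫`.
* CAP FAMILY (pole `e`): `Σ_{x,y ∈ C} K(u_x, u_y, ⟪x,y⟫) ≥ 0` for a factored cap kernel `K` — the tree's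
  `BachocVallentin.sum_sum_capKernel3_nonneg` ([BachocVallentin2009, Thm 2.2]; p3's `SphericalCapKernel`).
* POLE BLOCKS (pole = each code point `x`, point set `C ∪ {p}`): for factored pole kernels
  `S_fg(A,B,C) = Σ_k Σ_r f_{k,r}(A) g_{k,r}(B) Q3 k (A,B,C)` (`poleKernel3`; the blocks `G11, G12, G22` of
  `G_k = M_k M_kᵀ` give `S11 = S_aa`, `S12 = S_ab`, `S22 = S_bb` with `a`/`b` the two halves of the
  columns of `M_k` paired with the row basis),
  `Σ_{y,z ∈ C} S_aa(⟪x,y⟫,⟪x,z⟫,⟪y,z⟫) + 2 Σ_{y ∈ C} S_ab(⟪x,y⟫,⟪x,p⟫,⟪y,p⟫) + S_bb(⟪x,p⟫,⟪x,p⟫,1) ≥ 0`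
  — `BachocVallentin.sum_sum_Q3_nonneg` ([BachocVallentin2007, Cor. 3.5]) with pole `x`, index set
  `insertNone C`, weights `a_{k,r}(⟪x,y⟫)` on `C` and `b_{k,r}(⟪x,p⟫)` on `p`, summed over `(k,r)`
  (`poleBlock_nonneg`): the cell's «feature-map» validity argument, with no new analysis.
* BOOKKEEPING (`accounting`): the two displays summed over `x ∈ C` split by coincidences into `|C|`
  singles `D(u) = K(u,u,1) + S11(1,1,1) + 2 S12(1,-u,-u) + S22(-u,-u,1)`, `|C|(|C|-1)` ordered pairs
  `P(u,v,t) = K(u,v,t) + S11(1,t,t) + S11(t,1,t) + S11(t,t,1) + S12(t,-u,-v) + S12(t,-v,-u)` on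
  `Δ(u₀,s) = [u₀,1]² × [-1,s] ∩ {1 + 2uvt - u² - v² - t² ≥ 0}`, and ordered distinct triples whose
  pole-`x` terms `S11(⟪x,y⟫,⟪x,z⟫,⟪y,z⟫)` symmetrise by REINDEXING (`tripleSum_perm23`, `tripleSum_cyc`)
  to one third of `S₃ = sym3 S11`, `S₃(a,b,c) = S11(a,b,c) + S11(a,c,b) + S11(b,c,a)`, on
  `R₃(s) = [-1,s]³ ∩ {Gram ≥ 0}`. Hence (I) `D ≤ M`, (II) `P ≤ -λ`, (III) `S₃ ≤ ε₃` give
  `0 ≤ |C|·M - |C|(|C|-1)·λ + |C|(|C|-1)(|C|-2)/3 · ε₃`. The integer reading ((N) ⇒ `|C| ≤ 11` ⇒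
  `CapCodeBound u₀` ⇒ `NoHole (-u₀)`) and the certificate FORMAT `X2Cert` are in `Bulk/CapX2Cert.lean`.

References: C. Bachoc, F. Vallentin, J. Amer. Math. Soc. 21 (2008) 909–924, Cor. 3.5
[`BachocVallentin2007`]; European J. Combin. 30 (2009) 625–637, Thm 2.2/4.4 [`BachocVallentin2009`].
-/
noncomputable section

open Finset
open scoped InnerProductSpace
open Literature.Geometry.DiscreteGeometry Literature.Geometry.DiscreteGeometry.BachocVallentin

namespace Summit.Ventures.Crystal3D.CapX2

/-! ## Factored pole kernels and their positivity -/

/-- A factored pole kernel on `S²`: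
`poleKernel3 K R f g A B C = Σ_{k<K} Σ_{r<R} f k r A · g k r B · Q3 k A B C`
(`= Σ_k ⟨G_k, f-basis(A) g-basis(B)ᵀ⟩ Q_k(A,B,C)` for a block `G_k = F⁽¹⁾_k (F⁽²⁾_k)ᵀ` of a factored
positive semidefinite matrix). The cap kernel `capKernel3 K R g` is `poleKernel3 K R g g`. -/
def poleKernel3 (K R : ℕ) (f g : ℕ → ℕ → ℝ → ℝ) (A B C : ℝ) : ℝ :=
  ∑ k ∈ range K, ∑ r ∈ range R, f k r A * g k r B * Q3 k A B C

/-- Transposition symmetry: `S_fg(A,B,C) = S_gf(B,A,C)` (`Q3` is symmetric in its first two arguments). -/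
theorem poleKernel3_swap (K R : ℕ) (f g : ℕ → ℕ → ℝ → ℝ) (A B C : ℝ) :
    poleKernel3 K R f g A B C = poleKernel3 K R g f B A C := by
  unfold poleKernel3
  refine sum_congr rfl fun k _ => sum_congr rfl fun r _ => ?_
  rw [CapCut.Q3_swap]; ring

/-- Reindexing: a double sum of a double `(k, r)`-sum is the `(k, r)`-sum of the double sums. -/
private theorem sum2_sum2_comm {α β : Type*} (s : Finset α) (t : Finset β) (K R : ℕ)
    (f : α → β → ℕ → ℕ → ℝ) :
    (∑ y ∈ s, ∑ z ∈ t, ∑ k ∈ range K, ∑ r ∈ range R, f y z k r) =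
      ∑ k ∈ range K, ∑ r ∈ range R, ∑ y ∈ s, ∑ z ∈ t, f y z k r := by
  calc (∑ y ∈ s, ∑ z ∈ t, ∑ k ∈ range K, ∑ r ∈ range R, f y z k r)
      = ∑ y ∈ s, ∑ k ∈ range K, ∑ z ∈ t, ∑ r ∈ range R, f y z k r :=
        sum_congr rfl fun _ _ => sum_comm
    _ = ∑ y ∈ s, ∑ k ∈ range K, ∑ r ∈ range R, ∑ z ∈ t, f y z k r :=
        sum_congr rfl fun _ _ => sum_congr rfl fun _ _ => sum_comm
    _ = ∑ k ∈ range K, ∑ y ∈ s, ∑ r ∈ range R, ∑ z ∈ t, f y z k r := sum_comm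
    _ = ∑ k ∈ range K, ∑ r ∈ range R, ∑ y ∈ s, ∑ z ∈ t, f y z k r :=
        sum_congr rfl fun _ _ => sum_comm

/-- Reindexing: a single sum of a double `(k, r)`-sum. -/
private theorem sum_sum2_comm {α : Type*} (s : Finset α) (K R : ℕ) (f : α → ℕ → ℕ → ℝ) :
    (∑ y ∈ s, ∑ k ∈ range K, ∑ r ∈ range R, f y k r) =
      ∑ k ∈ range K, ∑ r ∈ range R, ∑ y ∈ s, f y k r := by
  calc (∑ y ∈ s, ∑ k ∈ range K, ∑ r ∈ range R, f y k r)
      = ∑ k ∈ range K, ∑ y ∈ s, ∑ r ∈ range R, f y k r := sum_comm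
    _ = ∑ k ∈ range K, ∑ r ∈ range R, ∑ y ∈ s, f y k r := sum_congr rfl fun _ _ => sum_comm

/-- **Positivity of a pole block** ((pos Y) around the pole `x` for the point set `C ∪ {p}`, aggregated
over the partition `{C}, {p}` with the factor's column weights): for unit vectors `x, p`, a finite set
`C` of unit vectors and any `a, b`,
`Σ_{y,z∈C} S_aa(⟪x,y⟫,⟪x,z⟫,⟪y,z⟫) + 2 Σ_{y∈C} S_ab(⟪x,y⟫,⟪x,p⟫,⟪y,p⟫) + S_bb(⟪x,p⟫,⟪x,p⟫,1) ≥ 0`.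
This is the validity of the cell's X2 blocks `B_k(x) ⪰ 0` (theory-2 §21.9.8 feature map; theory-1 §8.5′),
obtained from `BachocVallentin.sum_sum_Q3_nonneg` [BachocVallentin2007, Cor. 3.5] and nothing else. -/
theorem poleBlock_nonneg (K R : ℕ) (a b : ℕ → ℕ → ℝ → ℝ) (x p : EuclideanSpace ℝ (Fin 3))
    (hx : ‖x‖ = 1) (hp : ‖p‖ = 1) (C : Finset (EuclideanSpace ℝ (Fin 3))) (hC : ∀ y ∈ C, ‖y‖ = 1) :
    0 ≤ (∑ y ∈ C, ∑ z ∈ C, poleKernel3 K R a a ⟪x, y⟫_ℝ ⟪x, z⟫_ℝ ⟪y, z⟫_ℝ)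
      + 2 * (∑ y ∈ C, poleKernel3 K R a b ⟪x, y⟫_ℝ ⟪x, p⟫_ℝ ⟪y, p⟫_ℝ)
      + poleKernel3 K R b b ⟪x, p⟫_ℝ ⟪x, p⟫_ℝ 1 := by
  classical
  have hpp : ⟪p, p⟫_ℝ = 1 := by rw [real_inner_self_eq_norm_sq, hp]; norm_num
  -- one `(k, r)` at a time: the fixed-pole `Q3` inequality on `insertNone C`
  have hkr : ∀ k r : ℕ, 0 ≤
      (∑ y ∈ C, ∑ z ∈ C, a k r ⟪x, y⟫_ℝ * a k r ⟪x, z⟫_ℝ * Q3 k ⟪x, y⟫_ℝ ⟪x, z⟫_ℝ ⟪y, z⟫_ℝ)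
      + 2 * (∑ y ∈ C, a k r ⟪x, y⟫_ℝ * b k r ⟪x, p⟫_ℝ * Q3 k ⟪x, y⟫_ℝ ⟪x, p⟫_ℝ ⟪y, p⟫_ℝ)
      + b k r ⟪x, p⟫_ℝ * b k r ⟪x, p⟫_ℝ * Q3 k ⟪x, p⟫_ℝ ⟪x, p⟫_ℝ 1 := by
    intro k r
    have key := sum_sum_Q3_nonneg k x hx (insertNone C)
      (fun o => o.elim (b k r ⟪x, p⟫_ℝ) (fun y => a k r ⟪x, y⟫_ℝ)) (fun o => o.elim p id)
      (by
        intro o ho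
        cases o with
        | none => exact hp
        | some y => exact hC y (by simpa using ho))
    simp only [sum_insertNone, Option.elim, id, hpp] at key
    have hcross : ∀ z ∈ C, b k r ⟪x, p⟫_ℝ * a k r ⟪x, z⟫_ℝ * Q3 k ⟪x, p⟫_ℝ ⟪x, z⟫_ℝ ⟪p, z⟫_ℝ
        = a k r ⟪x, z⟫_ℝ * b k r ⟪x, p⟫_ℝ * Q3 k ⟪x, z⟫_ℝ ⟪x, p⟫_ℝ ⟪z, p⟫_ℝ := by
      intro z _
      rw [CapCut.Q3_swap, real_inner_comm p z]; ring
    rw [sum_congr rfl hcross, sum_add_distrib] at key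
    linarith
  -- sum over `(k, r)`
  have htot : 0 ≤ ∑ k ∈ range K, ∑ r ∈ range R,
      ((∑ y ∈ C, ∑ z ∈ C, a k r ⟪x, y⟫_ℝ * a k r ⟪x, z⟫_ℝ * Q3 k ⟪x, y⟫_ℝ ⟪x, z⟫_ℝ ⟪y, z⟫_ℝ)
      + 2 * (∑ y ∈ C, a k r ⟪x, y⟫_ℝ * b k r ⟪x, p⟫_ℝ * Q3 k ⟪x, y⟫_ℝ ⟪x, p⟫_ℝ ⟪y, p⟫_ℝ)
      + b k r ⟪x, p⟫_ℝ * b k r ⟪x, p⟫_ℝ * Q3 k ⟪x, p⟫_ℝ ⟪x, p⟫_ℝ 1) :=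
    sum_nonneg fun k _ => sum_nonneg fun r _ => hkr k r
  have e1 : (∑ y ∈ C, ∑ z ∈ C, poleKernel3 K R a a ⟪x, y⟫_ℝ ⟪x, z⟫_ℝ ⟪y, z⟫_ℝ) =
      ∑ k ∈ range K, ∑ r ∈ range R, ∑ y ∈ C, ∑ z ∈ C,
        a k r ⟪x, y⟫_ℝ * a k r ⟪x, z⟫_ℝ * Q3 k ⟪x, y⟫_ℝ ⟪x, z⟫_ℝ ⟪y, z⟫_ℝ := by
    unfold poleKernel3; exact sum2_sum2_comm C C K R _
  have e2 : (∑ y ∈ C, poleKernel3 K R a b ⟪x, y⟫_ℝ ⟪x, p⟫_ℝ ⟪y, p⟫_ℝ) =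
      ∑ k ∈ range K, ∑ r ∈ range R, ∑ y ∈ C,
        a k r ⟪x, y⟫_ℝ * b k r ⟪x, p⟫_ℝ * Q3 k ⟪x, y⟫_ℝ ⟪x, p⟫_ℝ ⟪y, p⟫_ℝ := by
    unfold poleKernel3; exact sum_sum2_comm C K R _
  rw [e1, e2]
  unfold poleKernel3
  simpa only [sum_add_distrib, mul_sum] using htot

/-- The pole block with `p = -e` the antipode of a cap centre `e`, written in the cap coordinates
`u_y = ⟪e, y⟫` (`⟪y, p⟫ = -u_y`): the form used in the accounting. -/
theorem poleBlock_nonneg_antipode (K R : ℕ) (a b : ℕ → ℕ → ℝ → ℝ) (e x : EuclideanSpace ℝ (Fin 3))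
    (he : ‖e‖ = 1) (hx : ‖x‖ = 1) (C : Finset (EuclideanSpace ℝ (Fin 3))) (hC : ∀ y ∈ C, ‖y‖ = 1) :
    0 ≤ (∑ y ∈ C, ∑ z ∈ C, poleKernel3 K R a a ⟪x, y⟫_ℝ ⟪x, z⟫_ℝ ⟪y, z⟫_ℝ)
      + 2 * (∑ y ∈ C, poleKernel3 K R a b ⟪x, y⟫_ℝ (-⟪e, x⟫_ℝ) (-⟪e, y⟫_ℝ))
      + poleKernel3 K R b b (-⟪e, x⟫_ℝ) (-⟪e, x⟫_ℝ) 1 := by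
  have h := poleBlock_nonneg K R a b x (-e) hx (by rw [norm_neg, he]) C hC
  have hneg : ∀ y : EuclideanSpace ℝ (Fin 3), ⟪y, -e⟫_ℝ = -⟪e, y⟫_ℝ := fun y => by
    rw [inner_neg_right, real_inner_comm]
  simpa only [hneg] using h

/-! ## The accounting -/

/-- The pole-symmetrisation of a three-argument function: `sym3 S (a,b,c) = S(a,b,c) + S(a,c,b) + S(b,c,a)`
(for the inner products `a = ⟪x,y⟫, b = ⟪x,z⟫, c = ⟪y,z⟫` of a triple: the pole-`x`, pole-`y` and pole-`z`
readings). FORMAT-t2x2's `S₃` is `sym3 S11`. -/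
def sym3 (S : ℝ → ℝ → ℝ → ℝ) (a b c : ℝ) : ℝ := S a b c + S a c b + S b c a


/-- **The X2 accounting (abstract form).** Let `C ⊂ S²` be a finite `s`-code in the cap `⟪e,·⟫ ≥ u₀`
(`e` a unit vector, `u_x = ⟪e,x⟫`), and let `Kp, S11, S12, S22 : ℝ³ → ℝ` satisfy the two positivity
displays (cap family; pole blocks with `p = -e`) and `S11(u,v,t) = S11(v,u,t)`. If
(I) `Kp(u,u,1) + S11(1,1,1) + 2 S12(1,-u,-u) + S22(-u,-u,1) ≤ M` on `[u₀,1]`,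
(II) `Kp(u,v,t) + S11(1,t,t) + S11(t,1,t) + S11(t,t,1) + S12(t,-u,-v) + S12(t,-v,-u) ≤ -λ` on `Δ(u₀,s)`,
(III) `S11(a,b,c) + S11(a,c,b) + S11(b,c,a) ≤ ε₃` on `[-1,s]³ ∩ {1 + 2abc - a² - b² - c² ≥ 0}`, then
`0 ≤ |C|·M - |C|(|C|-1)·λ + |C|(|C|-1)(|C|-2)/3·ε₃`. (FORMAT-t2x2 «WHAT IS CERTIFIED»: the implication.) -/
theorem accounting (s u₀ : ℝ) (e : EuclideanSpace ℝ (Fin 3)) (he : ‖e‖ = 1)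
    (C : Finset (EuclideanSpace ℝ (Fin 3))) (hC : ∀ x ∈ C, ‖x‖ = 1)
    (hcode : ∀ x ∈ C, ∀ y ∈ C, x ≠ y → ⟪x, y⟫_ℝ ≤ s) (hcap : ∀ x ∈ C, u₀ ≤ ⟪e, x⟫_ℝ)
    (Kp S11 S12 S22 : ℝ → ℝ → ℝ → ℝ) (M lam eps3 : ℝ)
    (hK : 0 ≤ ∑ x ∈ C, ∑ y ∈ C, Kp ⟪e, x⟫_ℝ ⟪e, y⟫_ℝ ⟪x, y⟫_ℝ)
    (hblock : ∀ x ∈ C, 0 ≤ (∑ y ∈ C, ∑ z ∈ C, S11 ⟪x, y⟫_ℝ ⟪x, z⟫_ℝ ⟪y, z⟫_ℝ)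
      + 2 * (∑ y ∈ C, S12 ⟪x, y⟫_ℝ (-⟪e, x⟫_ℝ) (-⟪e, y⟫_ℝ)) + S22 (-⟪e, x⟫_ℝ) (-⟪e, x⟫_ℝ) 1)
    (hS : ∀ u v t : ℝ, S11 u v t = S11 v u t)
    (h1 : ∀ u : ℝ, u₀ ≤ u → u ≤ 1 →
      Kp u u 1 + S11 1 1 1 + 2 * S12 1 (-u) (-u) + S22 (-u) (-u) 1 ≤ M)
    (h2 : ∀ u v t : ℝ, u₀ ≤ u → u ≤ 1 → u₀ ≤ v → v ≤ 1 → -1 ≤ t → t ≤ s →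
      0 ≤ 1 + 2 * u * v * t - u ^ 2 - v ^ 2 - t ^ 2 →
      Kp u v t + S11 1 t t + S11 t 1 t + S11 t t 1 + S12 t (-u) (-v) + S12 t (-v) (-u) ≤ -lam)
    (h3 : ∀ a b c : ℝ, -1 ≤ a → a ≤ s → -1 ≤ b → b ≤ s → -1 ≤ c → c ≤ s →
      0 ≤ 1 + 2 * a * b * c - a ^ 2 - b ^ 2 - c ^ 2 → S11 a b c + S11 a c b + S11 b c a ≤ eps3) :
    0 ≤ (C.card : ℝ) * M - C.card * (C.card - 1) * lam
      + C.card * (C.card - 1) * (C.card - 2) / 3 * eps3 := by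
  classical
  set N : ℝ := (C.card : ℝ) with hN
  by_cases hCe : C = ∅
  · simp [hN, hCe]
  have hself : ∀ x ∈ C, ⟪x, x⟫_ℝ = (1 : ℝ) := fun x hx => by
    rw [real_inner_self_eq_norm_sq, hC x hx]; norm_num
  have hcap1 : ∀ x ∈ C, ⟪e, x⟫_ℝ ≤ 1 := by
    intro x hx
    have h := real_inner_le_norm e x
    rw [he, hC x hx, one_mul] at h
    exact h
  have hrange : ∀ x ∈ C, ∀ y ∈ C, x ≠ y → -1 ≤ ⟪x, y⟫_ℝ ∧ ⟪x, y⟫_ℝ ≤ s := by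
    intro x hx y hy hxy
    refine ⟨?_, hcode x hx y hy hxy⟩
    have h := abs_real_inner_le_norm x y
    rw [hC x hx, hC y hy, mul_one] at h
    exact (abs_le.1 h).1
  have hcard1 : ∀ x ∈ C, ((C.erase x).card : ℝ) = N - 1 := by
    intro x hx
    rw [Finset.card_erase_of_mem hx, Nat.cast_sub (Finset.card_pos.2 ⟨x, hx⟩), hN]; simp
  have hcard2 : ∀ x ∈ C, ∀ y ∈ C.erase x, (((C.erase x).erase y).card : ℝ) = N - 2 := by
    intro x hx y hy
    have h2 : 2 ≤ C.card := by
      have : (C.erase x).card = C.card - 1 := Finset.card_erase_of_mem hx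
      have hp : 0 < (C.erase x).card := Finset.card_pos.2 ⟨y, hy⟩
      omega
    rw [Finset.card_erase_of_mem hy, Finset.card_erase_of_mem hx, Nat.sub_sub,
      Nat.cast_sub h2, hN]
    norm_num
  -- the symmetrised triple function `sym3 S11` is symmetric
  have hS3_12 : ∀ u v t, sym3 S11 u v t = sym3 S11 v u t := by
    intro u v t; simp only [sym3]; rw [hS u v t]; ring
  have hS3_23 : ∀ u v t, sym3 S11 u v t = sym3 S11 u t v := by
    intro u v t; simp only [sym3]; rw [hS v t u]; ring
  -- (a) the pole-`x` triple terms are one third of the symmetrised ones (reindexing)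
  have hsym : (∑ x ∈ C, ∑ y ∈ C, ∑ z ∈ C, S11 ⟪x, y⟫_ℝ ⟪x, z⟫_ℝ ⟪y, z⟫_ℝ)
      = (1 / 3 : ℝ) * BachocVallentin.tripleSum C (sym3 S11) := by
    have e0 : BachocVallentin.tripleSum C (sym3 S11) = BachocVallentin.tripleSum C S11
        + BachocVallentin.tripleSum C (fun u v t => S11 u t v)
        + BachocVallentin.tripleSum C (fun u v t => S11 v t u) := by
      simp only [BachocVallentin.tripleSum, sym3, Finset.sum_add_distrib]
    rw [e0, BachocVallentin.tripleSum_perm23 C S11, (BachocVallentin.tripleSum_cyc C S11).1]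
    unfold BachocVallentin.tripleSum; ring
  -- (b) split the symmetrised triple sum by coincidences (as in [BachocVallentin2007, §4])
  have htriple : BachocVallentin.tripleSum C (sym3 S11) = N * sym3 S11 1 1 1
      + 3 * ∑ x ∈ C, ∑ y ∈ C.erase x, sym3 S11 ⟪x, y⟫_ℝ ⟪x, y⟫_ℝ 1
      + ∑ x ∈ C, ∑ y ∈ C.erase x, ∑ z ∈ (C.erase x).erase y,
          sym3 S11 ⟪x, y⟫_ℝ ⟪x, z⟫_ℝ ⟪y, z⟫_ℝ := by
    unfold BachocVallentin.tripleSum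
    have hx_split : ∀ x ∈ C,
        (∑ y ∈ C, ∑ z ∈ C, sym3 S11 ⟪x, y⟫_ℝ ⟪x, z⟫_ℝ ⟪y, z⟫_ℝ) =
          sym3 S11 1 1 1 + 3 * ∑ y ∈ C.erase x, sym3 S11 ⟪x, y⟫_ℝ ⟪x, y⟫_ℝ 1 +
            ∑ y ∈ C.erase x, ∑ z ∈ (C.erase x).erase y, sym3 S11 ⟪x, y⟫_ℝ ⟪x, z⟫_ℝ ⟪y, z⟫_ℝ := by
      intro x hx
      rw [← Finset.add_sum_erase C _ hx]
      have hyx : (∑ z ∈ C, sym3 S11 ⟪x, x⟫_ℝ ⟪x, z⟫_ℝ ⟪x, z⟫_ℝ) =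
          sym3 S11 1 1 1 + ∑ z ∈ C.erase x, sym3 S11 ⟪x, z⟫_ℝ ⟪x, z⟫_ℝ 1 := by
        rw [← Finset.add_sum_erase C _ hx, hself x hx]
        congr 1
        refine Finset.sum_congr rfl fun z _ => ?_
        rw [hS3_12, hS3_23]
      have hyne : ∀ y ∈ C.erase x,
          (∑ z ∈ C, sym3 S11 ⟪x, y⟫_ℝ ⟪x, z⟫_ℝ ⟪y, z⟫_ℝ) =
            2 * sym3 S11 ⟪x, y⟫_ℝ ⟪x, y⟫_ℝ 1 +
              ∑ z ∈ (C.erase x).erase y, sym3 S11 ⟪x, y⟫_ℝ ⟪x, z⟫_ℝ ⟪y, z⟫_ℝ := by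
        intro y hy
        have hyC : y ∈ C := Finset.mem_of_mem_erase hy
        rw [← Finset.add_sum_erase C _ hx, ← Finset.add_sum_erase (C.erase x) _ hy, hself x hx,
          hself y hyC, real_inner_comm x y]
        have e1 : sym3 S11 ⟪x, y⟫_ℝ 1 ⟪x, y⟫_ℝ = sym3 S11 ⟪x, y⟫_ℝ ⟪x, y⟫_ℝ 1 := by rw [hS3_23]
        rw [e1]; ring
      rw [hyx, Finset.sum_congr rfl hyne, Finset.sum_add_distrib, ← Finset.mul_sum]
      ring
    rw [Finset.sum_congr rfl hx_split, Finset.sum_add_distrib, Finset.sum_add_distrib,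
      Finset.sum_const, nsmul_eq_mul, ← hN, ← Finset.mul_sum]
  -- (c) split the pair-indexed sums by `y = x` / `y ≠ x`
  have hpairK : (∑ x ∈ C, ∑ y ∈ C, Kp ⟪e, x⟫_ℝ ⟪e, y⟫_ℝ ⟪x, y⟫_ℝ)
      = (∑ x ∈ C, Kp ⟪e, x⟫_ℝ ⟪e, x⟫_ℝ 1)
        + ∑ x ∈ C, ∑ y ∈ C.erase x, Kp ⟪e, x⟫_ℝ ⟪e, y⟫_ℝ ⟪x, y⟫_ℝ := by
    rw [← Finset.sum_add_distrib]
    refine Finset.sum_congr rfl fun x hx => ?_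
    rw [← Finset.add_sum_erase C _ hx, hself x hx]
  have hpair12 : (∑ x ∈ C, ∑ y ∈ C, S12 ⟪x, y⟫_ℝ (-⟪e, x⟫_ℝ) (-⟪e, y⟫_ℝ))
      = (∑ x ∈ C, S12 1 (-⟪e, x⟫_ℝ) (-⟪e, x⟫_ℝ))
        + ∑ x ∈ C, ∑ y ∈ C.erase x, S12 ⟪x, y⟫_ℝ (-⟪e, x⟫_ℝ) (-⟪e, y⟫_ℝ) := by
    rw [← Finset.sum_add_distrib]
    refine Finset.sum_congr rfl fun x hx => ?_
    rw [← Finset.add_sum_erase C _ hx, hself x hx]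
  -- (d) symmetrise the ordered-pair `S12` terms by swapping the summation variables
  have hswap12 : (∑ x ∈ C, ∑ y ∈ C.erase x, S12 ⟪x, y⟫_ℝ (-⟪e, x⟫_ℝ) (-⟪e, y⟫_ℝ))
      = ∑ x ∈ C, ∑ y ∈ C.erase x, S12 ⟪x, y⟫_ℝ (-⟪e, y⟫_ℝ) (-⟪e, x⟫_ℝ) := by
    have hl : (∑ x ∈ C, ∑ y ∈ C.erase x, S12 ⟪x, y⟫_ℝ (-⟪e, x⟫_ℝ) (-⟪e, y⟫_ℝ))
        = (∑ x ∈ C, ∑ y ∈ C, S12 ⟪x, y⟫_ℝ (-⟪e, x⟫_ℝ) (-⟪e, y⟫_ℝ))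
          - ∑ x ∈ C, S12 1 (-⟪e, x⟫_ℝ) (-⟪e, x⟫_ℝ) := by
      rw [← Finset.sum_sub_distrib]
      refine Finset.sum_congr rfl fun x hx => ?_
      rw [Finset.sum_erase_eq_sub hx, hself x hx]
    have hr : (∑ x ∈ C, ∑ y ∈ C.erase x, S12 ⟪x, y⟫_ℝ (-⟪e, y⟫_ℝ) (-⟪e, x⟫_ℝ))
        = (∑ x ∈ C, ∑ y ∈ C, S12 ⟪x, y⟫_ℝ (-⟪e, y⟫_ℝ) (-⟪e, x⟫_ℝ))
          - ∑ x ∈ C, S12 1 (-⟪e, x⟫_ℝ) (-⟪e, x⟫_ℝ) := by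
      rw [← Finset.sum_sub_distrib]
      refine Finset.sum_congr rfl fun x hx => ?_
      rw [Finset.sum_erase_eq_sub hx, hself x hx]
    rw [hl, hr, Finset.sum_comm]
    congr 1
    refine Finset.sum_congr rfl fun y _ => Finset.sum_congr rfl fun x _ => ?_
    rw [real_inner_comm x y]
  -- (e) bounds: singles
  have hb1 : (∑ x ∈ C, (Kp ⟪e, x⟫_ℝ ⟪e, x⟫_ℝ 1 + S11 1 1 1 + 2 * S12 1 (-⟪e, x⟫_ℝ) (-⟪e, x⟫_ℝ)
      + S22 (-⟪e, x⟫_ℝ) (-⟪e, x⟫_ℝ) 1)) ≤ N * M := by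
    have h := Finset.sum_le_card_nsmul C
      (fun x => Kp ⟪e, x⟫_ℝ ⟪e, x⟫_ℝ 1 + S11 1 1 1 + 2 * S12 1 (-⟪e, x⟫_ℝ) (-⟪e, x⟫_ℝ)
        + S22 (-⟪e, x⟫_ℝ) (-⟪e, x⟫_ℝ) 1) M (fun x hx => h1 _ (hcap x hx) (hcap1 x hx))
    rwa [nsmul_eq_mul, ← hN] at h
  -- ordered pairs
  have hb2 : (∑ x ∈ C, ∑ y ∈ C.erase x, (Kp ⟪e, x⟫_ℝ ⟪e, y⟫_ℝ ⟪x, y⟫_ℝ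
      + sym3 S11 ⟪x, y⟫_ℝ ⟪x, y⟫_ℝ 1
      + S12 ⟪x, y⟫_ℝ (-⟪e, x⟫_ℝ) (-⟪e, y⟫_ℝ) + S12 ⟪x, y⟫_ℝ (-⟪e, y⟫_ℝ) (-⟪e, x⟫_ℝ)))
      ≤ N * (N - 1) * (-lam) := by
    have hrow : ∀ x ∈ C, (∑ y ∈ C.erase x, (Kp ⟪e, x⟫_ℝ ⟪e, y⟫_ℝ ⟪x, y⟫_ℝ
        + sym3 S11 ⟪x, y⟫_ℝ ⟪x, y⟫_ℝ 1
        + S12 ⟪x, y⟫_ℝ (-⟪e, x⟫_ℝ) (-⟪e, y⟫_ℝ) + S12 ⟪x, y⟫_ℝ (-⟪e, y⟫_ℝ) (-⟪e, x⟫_ℝ)))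
        ≤ (N - 1) * (-lam) := by
      intro x hx
      rw [← hcard1 x hx]
      have h := Finset.sum_le_card_nsmul (C.erase x)
        (fun y => Kp ⟪e, x⟫_ℝ ⟪e, y⟫_ℝ ⟪x, y⟫_ℝ
          + sym3 S11 ⟪x, y⟫_ℝ ⟪x, y⟫_ℝ 1
          + S12 ⟪x, y⟫_ℝ (-⟪e, x⟫_ℝ) (-⟪e, y⟫_ℝ) + S12 ⟪x, y⟫_ℝ (-⟪e, y⟫_ℝ) (-⟪e, x⟫_ℝ)) (-lam)
        (fun y hy => by
          have hyC : y ∈ C := Finset.mem_of_mem_erase hy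
          have hxy : x ≠ y := fun h => (Finset.ne_of_mem_erase hy) h.symm
          obtain ⟨lo, hi⟩ := hrange x hx y hyC hxy
          have h := h2 _ _ _ (hcap x hx) (hcap1 x hx) (hcap y hyC) (hcap1 y hyC) lo hi
            (gram3_nonneg e x y he (hC x hx) (hC y hyC))
          have e3 : sym3 S11 ⟪x, y⟫_ℝ ⟪x, y⟫_ℝ 1
              = S11 1 ⟪x, y⟫_ℝ ⟪x, y⟫_ℝ + S11 ⟪x, y⟫_ℝ 1 ⟪x, y⟫_ℝ + S11 ⟪x, y⟫_ℝ ⟪x, y⟫_ℝ 1 := by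
            simp only [sym3]; rw [hS 1]; ring
          simp only [e3]
          linarith)
      rwa [nsmul_eq_mul] at h
    calc _ ≤ ∑ x ∈ C, (N - 1) * (-lam) := Finset.sum_le_sum hrow
      _ = N * (N - 1) * (-lam) := by rw [Finset.sum_const, nsmul_eq_mul, ← hN]; ring
  -- ordered distinct triples
  have hb3 : (∑ x ∈ C, ∑ y ∈ C.erase x, ∑ z ∈ (C.erase x).erase y,
      sym3 S11 ⟪x, y⟫_ℝ ⟪x, z⟫_ℝ ⟪y, z⟫_ℝ) ≤ N * (N - 1) * (N - 2) * eps3 := by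
    have hin : ∀ x ∈ C, ∀ y ∈ C.erase x,
        (∑ z ∈ (C.erase x).erase y, sym3 S11 ⟪x, y⟫_ℝ ⟪x, z⟫_ℝ ⟪y, z⟫_ℝ) ≤ (N - 2) * eps3 := by
      intro x hx y hy
      rw [← hcard2 x hx y hy]
      have hyC : y ∈ C := Finset.mem_of_mem_erase hy
      have hxy : x ≠ y := fun h => (Finset.ne_of_mem_erase hy) h.symm
      have h := Finset.sum_le_card_nsmul ((C.erase x).erase y)
        (fun z => sym3 S11 ⟪x, y⟫_ℝ ⟪x, z⟫_ℝ ⟪y, z⟫_ℝ) eps3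
        (fun z hz => by
          have hz1 : z ∈ C.erase x := Finset.mem_of_mem_erase hz
          have hzC : z ∈ C := Finset.mem_of_mem_erase hz1
          have hzy : z ≠ y := Finset.ne_of_mem_erase hz
          have hzx : z ≠ x := Finset.ne_of_mem_erase hz1
          obtain ⟨lo1, hi1⟩ := hrange x hx y hyC hxy
          obtain ⟨lo2, hi2⟩ := hrange x hx z hzC hzx.symm
          obtain ⟨lo3, hi3⟩ := hrange y hyC z hzC hzy.symm
          exact h3 _ _ _ lo1 hi1 lo2 hi2 lo3 hi3
            (gram3_nonneg x y z (hC x hx) (hC y hyC) (hC z hzC)))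
      rwa [nsmul_eq_mul] at h
    have hmid : ∀ x ∈ C, (∑ y ∈ C.erase x, ∑ z ∈ (C.erase x).erase y,
        sym3 S11 ⟪x, y⟫_ℝ ⟪x, z⟫_ℝ ⟪y, z⟫_ℝ) ≤ (N - 1) * ((N - 2) * eps3) := by
      intro x hx
      rw [← hcard1 x hx]
      have h := Finset.sum_le_card_nsmul (C.erase x)
        (fun y => ∑ z ∈ (C.erase x).erase y, sym3 S11 ⟪x, y⟫_ℝ ⟪x, z⟫_ℝ ⟪y, z⟫_ℝ)
        ((N - 2) * eps3) (fun y hy => hin x hx y hy)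
      rwa [nsmul_eq_mul] at h
    calc _ ≤ ∑ x ∈ C, (N - 1) * ((N - 2) * eps3) := Finset.sum_le_sum hmid
      _ = N * (N - 1) * (N - 2) * eps3 := by rw [Finset.sum_const, nsmul_eq_mul, ← hN]; ring
  -- (f) combine: the nonnegative total, rewritten in terms of the bounded pieces
  have hpos : 0 ≤ (∑ x ∈ C, ∑ y ∈ C, Kp ⟪e, x⟫_ℝ ⟪e, y⟫_ℝ ⟪x, y⟫_ℝ)
      + ∑ x ∈ C, ((∑ y ∈ C, ∑ z ∈ C, S11 ⟪x, y⟫_ℝ ⟪x, z⟫_ℝ ⟪y, z⟫_ℝ)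
        + 2 * (∑ y ∈ C, S12 ⟪x, y⟫_ℝ (-⟪e, x⟫_ℝ) (-⟪e, y⟫_ℝ)) + S22 (-⟪e, x⟫_ℝ) (-⟪e, x⟫_ℝ) 1) :=
    add_nonneg hK (Finset.sum_nonneg fun x hx => hblock x hx)
  have hblocks : (∑ x ∈ C, ((∑ y ∈ C, ∑ z ∈ C, S11 ⟪x, y⟫_ℝ ⟪x, z⟫_ℝ ⟪y, z⟫_ℝ)
        + 2 * (∑ y ∈ C, S12 ⟪x, y⟫_ℝ (-⟪e, x⟫_ℝ) (-⟪e, y⟫_ℝ)) + S22 (-⟪e, x⟫_ℝ) (-⟪e, x⟫_ℝ) 1))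
      = (∑ x ∈ C, ∑ y ∈ C, ∑ z ∈ C, S11 ⟪x, y⟫_ℝ ⟪x, z⟫_ℝ ⟪y, z⟫_ℝ)
        + 2 * (∑ x ∈ C, ∑ y ∈ C, S12 ⟪x, y⟫_ℝ (-⟪e, x⟫_ℝ) (-⟪e, y⟫_ℝ))
        + ∑ x ∈ C, S22 (-⟪e, x⟫_ℝ) (-⟪e, x⟫_ℝ) 1 := by
    rw [Finset.sum_add_distrib, Finset.sum_add_distrib, ← Finset.mul_sum]
  have hsingles : (∑ x ∈ C, (Kp ⟪e, x⟫_ℝ ⟪e, x⟫_ℝ 1 + S11 1 1 1 + 2 * S12 1 (-⟪e, x⟫_ℝ) (-⟪e, x⟫_ℝ)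
      + S22 (-⟪e, x⟫_ℝ) (-⟪e, x⟫_ℝ) 1))
      = (∑ x ∈ C, Kp ⟪e, x⟫_ℝ ⟪e, x⟫_ℝ 1) + N * S11 1 1 1
        + 2 * (∑ x ∈ C, S12 1 (-⟪e, x⟫_ℝ) (-⟪e, x⟫_ℝ))
        + ∑ x ∈ C, S22 (-⟪e, x⟫_ℝ) (-⟪e, x⟫_ℝ) 1 := by
    rw [Finset.sum_add_distrib, Finset.sum_add_distrib, Finset.sum_add_distrib, Finset.sum_const,
      nsmul_eq_mul, ← hN, ← Finset.mul_sum]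
  have hpairs : (∑ x ∈ C, ∑ y ∈ C.erase x, (Kp ⟪e, x⟫_ℝ ⟪e, y⟫_ℝ ⟪x, y⟫_ℝ
      + sym3 S11 ⟪x, y⟫_ℝ ⟪x, y⟫_ℝ 1
      + S12 ⟪x, y⟫_ℝ (-⟪e, x⟫_ℝ) (-⟪e, y⟫_ℝ) + S12 ⟪x, y⟫_ℝ (-⟪e, y⟫_ℝ) (-⟪e, x⟫_ℝ)))
      = (∑ x ∈ C, ∑ y ∈ C.erase x, Kp ⟪e, x⟫_ℝ ⟪e, y⟫_ℝ ⟪x, y⟫_ℝ)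
        + (∑ x ∈ C, ∑ y ∈ C.erase x, sym3 S11 ⟪x, y⟫_ℝ ⟪x, y⟫_ℝ 1)
        + (∑ x ∈ C, ∑ y ∈ C.erase x, S12 ⟪x, y⟫_ℝ (-⟪e, x⟫_ℝ) (-⟪e, y⟫_ℝ))
        + ∑ x ∈ C, ∑ y ∈ C.erase x, S12 ⟪x, y⟫_ℝ (-⟪e, y⟫_ℝ) (-⟪e, x⟫_ℝ) := by
    simp only [Finset.sum_add_distrib]
  have hS3one : N * sym3 S11 1 1 1 = 3 * (N * S11 1 1 1) := by simp only [sym3]; ring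
  linarith [hpos, hblocks, hsym, htriple, hpairK, hpair12, hswap12, hb1, hb2, hb3, hsingles, hpairs,
    hS3one]

end Summit.Ventures.Crystal3D.CapX2

end
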